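import Mathlib
import HarnessLib
import HarnessLib.Audit
import Summits.SmoothPoincare4.Statement
import Literature.Topology.FourManifolds.ConnectedSum
import Literature.Topology.FourManifolds.ComplexProjectiveSpace
import Literature.Topology.FourManifolds.GluckTwist
import HarnessLib.Audit.Status.Attr

/-!
Route: DissolvableGluck

# Route DissolvableGluck — split ℂℙ²-cancellation along Melvin's seam — dissolvable ⇒ Gluck twist ⇒
standard

LENS = DECOMPOSITION-FIRST of the summit-strength leaf X₁ = CP2CancellationOne ("SPC4 for
ℂℙ²-dissolvable homotopy 4-spheres":
route TwistorDissolution's crux CP2Cancellation at n = 1, flagged summit-strength-unexplained; =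
smooth Kirby Problem 4.23 in
Σ-language via Melvin). TYPED SPLIT along Melvin's seam, X₁ ⟸ DIG ∧ GLUCK: DIG (crux
DissolvableIsGluck) — a homotopy 4-sphere M
with some connected sum M # ℂℙ² ≅ ℂℙ² is a Gluck twist Σ_K of S⁴ along some 2-knot K (on paper: the
degree-one sphere of ℂℙ² whose
complement is the punctured M can be chosen to meet a line transversally once); GLUCK (crux
GluckTwistsStandard) — every Gluck twist
of S⁴ is diffeomorphic to S⁴ (the Gluck twist conjecture, verbatim the registered open
`GluckTwistConjecture.{0}`).
`splitGlue_holds : DIG → GLUCK → X₁` is PROVED and the split is EXACT, `splitExact_holds : X₁ ↔ DIG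
∧ GLUCK`, a tree theorem
(Gluck §17 and the dissolution of Gluck twists are discharged facts). The route decides the summit
through DISSOLVE₁ (crux
DissolveOne: every homotopy 4-sphere has a connected sum with ℂℙ² diffeomorphic to ℂℙ²): it suffices
to show DISSOLVE₁ ∧ DIG ∧ GLUCK.
No idea card realised (lens seat); card odd-light-bulb-cp2 (variant, not routed) shares the ℂℙ²
arena, see Novelty.
Lean: `Summit.SmoothPoincare4.SmoothPoincare4.Theses.DissolvableGluck.DissolveOne ∧
Summit.SmoothPoincare4.SmoothPoincare4.Theses.DissolvableGluck.DissolvableIsGluck ∧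
Summit.SmoothPoincare4.SmoothPoincare4.Theses.DissolvableGluck.GluckTwistsStandard`

## Assembly
Pure logic over the items (certified: folder Sketch.lean / glue.lean, `closes` 3 tactic lines, lean
check rc 0, 0 sorries, axioms
propext · Classical.choice · Quot.sound): SmoothPoincare4 unfolds to ∀ M (Hausdorff, second
countable, C^∞ atlas on 𝓡 4), M ≃ₕ S⁴ →
Nonempty (M ≃ₘ S⁴); given M and e, DissolveOne M e is a dissolving sum, DissolvableIsGluck turns it
into a 2-knot K with
IsGluckTwist (𝓡 4) M K, GluckTwistsStandard K M returns the diffeomorphism. `closes : DissolveOne →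
DissolvableIsGluck →
GluckTwistsStandard → SmoothPoincare4` uses every hypothesis; the target CP2CancellationOne and the
supports are not hypotheses.

Rationale: WHY THIS LINE. X₁ asks for a DIFFEOMORPHISM M ≅ S⁴ from one ℂℙ² summand, and as typed by
TwistorDissolution it silently contains the Gluck twist
conjecture (every Σ_K dissolves: GompfStipsicz1999 Ex. 5.2.7(b), KasprowskiPowellRay2023 Lem. 3.1,
tree theorem
gluckTwist_connectedSum_complexProjectivePlane_holds) with nothing said about the rest. Melvin's
blow-down dictionary (Melvin1977;
Gabai2020 Questions 10.16 and Remark 10.17; Kirby1997 Problem 4.23) factors it into two individually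
named, strictly weaker problems
whose conjunction is PROVABLY X₁: DIG only asks that the degree-one sphere S ⊂ ℂℙ² with contractible
complement admit a geometrically
dual LINE — an intersection-reduction problem S ∩ L ↦ one point for two (+1)-spheres, the arena of
finger/Whitney moves and of the
light-bulb technology (Gabai2020; immersed Whitney discs exist because π₁(ℂℙ² ∖ S) = 1), with
Gompf1991 (Cappell–Shaneson spheres
ARE Gluck twists, by Kirby calculus) as the worked precedent of recognising homotopy spheres as
Gluck twists without deciding
standardness; GLUCK is the classical conjecture with its own engines (Gordon twist-spins, ribbon and
0-concordant knots Melvin1977,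
GabaiNaylorSchwartz2025 Thm 5.5 / Question 5.6 via Σ° × I ≅ B⁵, Schoenflies-ball form = route
OneStabInvertible's InvertibleStandard).
Imported: embedded-surface 4-topology in ℂℙ² (blow-down, dual spheres), 5-dimensional handle
arguments (GNS); no analytic or
spectral reformulation. What prior routes do not do: TwistorDissolution keeps CANCEL≤4 monolithic
(its foreseen split is 4.23 +
bookkeeping, i.e. X₁ again); PIC / WeylBudget / CartanHadamardSwindle attack Gluck twists by metrics
or hosts but never isolate
"dissolvable ⇒ Gluck"; the negatives index is empty.

RANKED CRUXES. #0 CP2CancellationOne (target) — X₁ — every smooth homotopy 4-sphere M admitting a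
connected sum P of M with ℂℙ² that is diffeomorphic to ℂℙ² is diffeomorphic to S⁴
(TwistorDissolution's CP2Cancellation at n = 1, one sum instead of a chain; the tree's
IsConnectedSum is orientation-free, so both M # ℂℙ² and M # ℂℙ²bar readings are included). (why it
might fail: It is SPC4 on ℂℙ²-dissolvable spheres ⊇ all Gluck twists: one exotic Gluck twist or one
dissolvable non-Gluck exotic sphere kills it (= DIG ∧ GLUCK, proved).) [Kirby1997, Melvin1977,
Gabai2020, ManolescuMarengonSarkarWillis2023, GordonKirby1984]
#2 DissolvableIsGluck (crux) — DIG — if M is a smooth homotopy 4-sphere and some connected sum of M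
with ℂℙ² is diffeomorphic to ℂℙ², then M is a Gluck twist of S⁴ along some smooth 2-knot K (tree
`IsGluckTwist (𝓡 4) M K`). On paper (Melvin1977 = Gabai2020 Rem. 10.17): the (±1)-sphere S ⊂ ℂℙ²
whose complement is the punctured M can be re-chosen to meet a line transversally in one point;
blowing down along that line turns S into K and M into Σ_K. Birth line
bc/DissolvableIsGluck_birth.lean: stub_blowUpPresentation (dictionary) → stub_dualLine (the crux
proper) → stub_melvinBlowDown (Melvin). [difficulty: open-problem] (why it might fail: Every dual of
the degree-one sphere has odd Euler number, so Gabai's light-bulb/tubing moves (Gabai2020 Lem. 2.3)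
are unavailable and no engine embeds the Whitney discs; a dissolvable exotic sphere that is not a
Gluck twist refutes it (SPC4-shielded).) [Melvin1977, Gabai2020, Kirby1997, Gompf1991,
arXiv:1705.09989]
#3 DissolveOne (crux) — DISSOLVE₁ — every smooth homotopy 4-sphere M has a connected sum P of M with
ℂℙ² (orientation-free IsConnectedSum) diffeomorphic to ℂℙ². The r = 1, all-Σ form of ℂℙ²-dissolution
(MMSW 2023 Question 9.12 asks ∃ r and only for balanced-presentation spheres D(P)); a consequence of
SPC4 (proved: dissolveOne_of_spc4). Birth line bc/DissolveOne_birth.lean transfers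
TwistorDissolution to level one: stub_selfDualLevelOne (a PSC half-conformally-flat metric on some M
# ℂℙ²) → stub_poonLevelOne (Poon 1986: positive-type self-dual with τ = 1 is ℂℙ²). [difficulty:
open-problem] (why it might fail: Stronger than MMSW Q9.12 (∃ r, D(P) only): r = 1 for EVERY Σ; all
printed dissolutions (Gluck twists GS Ex. 5.2.7b, AC-trivial D(P), Akbulut–Yasui odd-form criterion)
start from a sphere/handle datum a general Σ lacks; an exotic ℂℙ²-sum kills it.)
[ManolescuMarengonSarkarWillis2023, arXiv:1910.08195, GompfStipsicz1999, AkbulutYasui2013,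
KasprowskiPowellRay2023, FreedmanGompfMorrisonWalker2010]
#4 GluckTwistsStandard (crux) — GLUCK — the Gluck twist conjecture: for every smooth 2-knot K and
every smooth 4-manifold X that is a Gluck twist of S⁴ along K, X ≅ S⁴. Verbatim the body of the
registered open `Literature.Topology.FourManifolds.GluckTwistConjecture.{0}` (Iff.rfl,
gluckTwistsStandard_iff), inlined as this route's own crux per the conjecture rule; = X₁ restricted
to Gluck twists (gluck_of_cancel, proved). Birth line bc/GluckTwistsStandard_birth.lean: §17 (tree
theorem) + stub_gluckInvertible (GNS 2025 Q5.6: Gluck twists are invertible / Schoenflies balls) +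
stub_invertibleStandard (= OneStabInvertible.InvertibleStandard, stmt-SmoothPoincare4-18065).
[difficulty: open-problem] (why it might fail: Open since 1962 (Kirby 4.24/4.45) and widely
suspected false: non-ribbon, non-twist-spun 2-knots (e.g. Cappell–Shaneson-type or knots with no
0-concordance to a ribbon knot) may give exotic Σ_K; every known detector is blind (A2, A3, A7).)
[GluckTAMS1962, Kirby1997, GabaiNaylorSchwartz2025, arXiv:2307.06388, Gompf1991, Akbulut2010,
ManolescuMarengonSarkarWillis2023]
#9 SplitGlue (support) — X_of_subs — DIG → GLUCK → X₁ (the typed split's implication; PROVED in the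
planner's Sketch.lean, theorem splitGlue_holds, 3 lines of logic). [difficulty: provable-now]
[Melvin1977, Gabai2020]
#9 SplitExact (support) — the split is exact — X₁ ↔ (DIG ∧ GLUCK). PROVED in Sketch.lean
(splitExact_holds): X₁ → DIG because S⁴ is the Gluck twist of the unknot (tree theorem
isGluckTwist_sphere_unknotTwo_holds, transported by IsOpenGluing.diffeomorph_comp_of_boundaryless);
X₁ → GLUCK because a Gluck twist is a homotopy sphere (IsGluckTwist.nonempty_homotopyEquiv_sphere,
Gluck §17, discharged) and dissolves (gluckTwist_connectedSum_complexProjectivePlane_holds,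
discharged) along a connected sum that exists (exists_isConnectedSum_holds). Needs the proof-only
imports GluckTwistHomotopySphereProofs, GluckTwistUnknotProofs, KnotsProofs,
HomotopyS4CompactProofs, ConnectedSumExistence, ConnectedSumTransportProofs,
Barriers.SmoothPoincare4.GluckTwistsDissolveConnectedSumProofs in the Theorems file. [difficulty:
provable-now] [GluckTAMS1962, KasprowskiPowellRay2023, GompfStipsicz1999]

TWO-LAYER PLAN. Foreseen glued splits (k ≤ 3, depth 1; the birth skeletons bc/*_birth.lean are their
typed first drafts, nothing filed now).
DissolvableIsGluck ⇐ BlowUpPresentation (dissolvable ⇒ a Melvin datum: tube embedding of O(1),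
puncture chart, end matching) →
DualLine (some Melvin datum has its sphere meeting the standard line transversally once) →
MelvinBlowDown (dual line ⇒ IsGluckTwist).
GluckTwistsStandard ⇐ GluckInvertible (every Gluck twist is a connected summand of S⁴; GNS 2025
Q5.6) → InvertibleStandard (shared
with OneStabInvertible, stmt-SmoothPoincare4-18065). DissolveOne ⇐ SelfDualLevelOne → PoonLevelOne
(TwistorDissolution at n = 1), or
a Kirby-calculus line through a 2-handle presentation when one exists.

KILL CRITERIA. Every crux is a consequence of SPC4 (consequences_of_spc4, proved), so a refutation
of DissolveOne, DissolvableIsGluck or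
GluckTwistsStandard for an explicit M exhibits an exotic 4-sphere and the route closes WITH the
problem (close --reason refuted:<Decl>;
the refuting theorem is ¬SPC4). A refutation AS STATED (orientation-free IsConnectedSum, universe,
instance binders) forces
`--restate`, not closure. Soft kills of the MECHANISM: (i) a theorem that no (+1)-sphere technique
can create a transverse line without
a framed dual (an odd-Euler no-go extending Gabai2020 Lem. 2.3 to an impossibility) — pivot DIG to
the 5-dimensional form "M° × I ≅
B⁵ for dissolvable M" (GabaiNaylorSchwartz2025) or retire; (ii) GLUCK refuted ⇒ SPC4 refuted (moot).
SPC4 proved elsewhere moots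
everything; CP2Cancellation (TwistorDissolution) proved elsewhere moots DIG ∧ GLUCK but not
DissolveOne; DISSOLVE≤4 does not moot DissolveOne.

NOT DECOMPOSED YET. The Melvin dictionary itself (blow-up presentation of a dissolvable sphere;
blow-down along a transverse line = Gluck twist; pair
connected sum (S⁴, K) # (ℂℙ², ℂℙ¹); Cerf/Palais disc uniqueness) — classical, size L–XL to
formalise, layer-2 children of DIG once a
prover claims it; oriented bookkeeping (IsOrientedConnectedSum exists but the cruxes are
orientation-free like the barrier file's
dissolution fact); the sub-family theorems of GLUCK (twist-spun, ribbon, 0-concordant, undisking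
number one) — support lemmas by
`--supports`, never items; any s-invariant / lasagna NEGATIVE companion (blind by A7, deliberately
absent).

CHEAPEST FALSIFIER. (i) Lookup (run this session, negative): is "ℂℙ²-dissolvable ⇒ Gluck twist" or
its negation in print? Gabai2020 p. 24 poses only the
sphere-level Questions 10.16 i)/ii) and reports Melvin1977 (0-concordant case); Kirby 4.23/4.24
(GordonKirby1984 p. 465) and MMSW
§9.3 (arXiv:1910.08195 p. 30, Questions 9.11/9.12) do not state it; arXiv/zbMATH queries ("Gluck
twist CP2 dissolve homotopy
4-sphere", "sphere CP^2 degree one unknotting Melvin") returned 0 relevant hits; every worked family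
is consistent (Cappell–Shaneson
spheres: dissolvable AND Gluck twists, Gompf1991; then standard, Akbulut2010/Gompf2010). (ii)
Cheapest kill of the typing: the §D.2
junk witnesses (empty manifold, S⁴ ⊔ S⁴, ℝℙ⁴, ℂℙ²) all fail the hypothesis M ≃ₕ S⁴; BC5 shows the
three cruxes compute at M = S⁴
(dissolveOne_sphere, dissolvableIsGluck_sphere, isGluckTwist_sphere_unknotTwo_holds). (iii) Cheapest
kill of the line: formalise
stub_melvinBlowDown for the UNKNOT datum (S = a conic-free line pushed off itself) — if the encoded
Melvin datum cannot even reproduce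
S⁴ = Σ_unknot, IsMelvinDatum is mistyped.

NUMBERS. Euler numbers: the degree-one sphere S and every dual of it have normal Euler number ±1
(odd ⇒ no framed dual, Gabai2020 Lem. 2.3
needs even); a line L has ℂℙ² ∖ N(L) = B⁴ and S ∖ N(L) is a slice disc of the Hopf fibre = unknot,
so (B⁴, S ∖ N(L)) ≅ (B⁴, D₀ # K)
with K = its capped 2-knot (Melvin1977; Gabai2020 Rem. 10.17). Dissolution level: r = 1 for Gluck
twists, both chiralities
(ManolescuMarengonSarkarWillis2023 Cor. 6.15 proof; RenWillis 2024 §6.10); MMSW Q9.12 asks ∃ r for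
D(P). Items at open: 7 (1 target,
3 cruxes, 2 supports, 1 assembly); birth stubs 7 (3 + 2 + 2), sorries = stubs.

DEFINITION REQUESTS. None needed to state the items (IsConnectedSum, ComplexProjectivePlane,
TwoKnot, IsGluckTwist exist). Foreseen for layer 2 of DIG:
`IsMelvinDatum` / `HasDualLine` (drafted and elaborating in bc/DissolvableIsGluck_birth.lean over
ComplexProjectiveSpace.affineChart,
CoordNeZero, Manifold.IsSmoothEmbedding) — to be filed `--kind definition --topic
Summits/SmoothPoincare4/SmoothPoincare4/Theorems`
by the prover who claims DIG, not now. Bib: Melvin1977 added this session (commit 4821bc83).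

Novelty: Searches (2026-08-17): lit search --source arxiv "Gluck twist CP2 dissolve homotopy 4-sphere" (0
hits); --source zbmath "sphere CP^2
degree one unknotting Melvin" (10 noise hits, none relevant); earlier this unit (cycle-2 session 1):
arXiv/zbMATH "Gluck twist" 2018+
(Isoshima 2309.06778, Fukuda 1811.05109, Kim 2009.07353, NaylorSchwartz 2009.05703, KPR 2206.14113,
GNS 2307.06388, IsoshimaOgawa
2305.12042, Naylor 1906.01495, Kuhrman 2507.03798 — none on dissolvable ⇒ Gluck); lit galaxy search
--star all "sphere in CP^2
homologous to CP^1" (0), "Gluck twist" --star pdf (0); OpenAlex/S2 rate-limited (429); lit read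
Gabai2020 pp. 24–25, GordonKirby1984
pp. 463–470, GabaiNaylorSchwartz2025 pp. 3–4, 13, MMSW p. 30; lean search over tree
(GluckTwistConjecture users, dissolv/Melvin decls);
ledger negatives (0). Nearest listed route: route-SmoothPoincare4-TwistorDissolution (crux
CP2Cancellation = CANCEL≤4, why-easier
empty; its own foreseen split is UnknotDegreeOneConfiguration + MelvinDictionary = Kirby 4.23 again)
and card odd-light-bulb-cp2
(UNKNOT(4.23, π₁ = 1 form) ∧ DISSOLVE; refuter note: "10.16 i) (dual ℂℙ¹) is the Gluck case; the π₁
= 1 class is a priori larger").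
Nearest prior art found: Melvin1977 / Gabai2020 Rem. 10.17 (blow-down ⇔ Gluck twist for spheres with
a dual line; Questions 10.16),
Gompf1991 (CS spheres are Gluck twists), ManolescuMarengonSarkarWillis2023 §9.3 (dissolution
questions), GabaiNaylorSchwartz2025 Q5.6.
Delta: the refuter's informal remark becomes a ty  [refs: Gabai2020, GordonKirby1984, GabaiNaylorSchwartz2025, Melvin1977, Gompf1991, ManolescuMarengonSarkarWillis2023]

Barriers (technique_class: blow-down, gluck-twist, cp2-dissolution, dual-sphere): - technique_class: blow-down, gluck-twist, cp2-dissolution, dual-sphere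
- Literature.Barriers.SmoothPoincare4.GluckTwistCP2Barrier: used POSITIVELY, not evaded — the
dissolution fact behind A7 is exactly what proves X₁ → GLUCK (splitExact_holds); the barrier kills
ℂℙ²-cancellative DETECTORS and the s-strategy, i.e. refutations of GLUCK/DIG, which this positive
route does not attempt; consequence acknowledged: no invariant surviving # ℂℙ² can referee any of
the three cruxes.
- Literature.Barriers.SmoothPoincare4.StableBarrierFour: does not apply — no S²×S²-stable invariant
is used; the line produces a 2-knot and a diffeomorphism, not an invariant.
- Literature.Barriers.SmoothPoincare4.HCobordismBarrierFour: does not apply — no h-cobordism ⇒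
diffeo step; GLUCK's foreseen line is GNS's Σ°×I ≅ B⁵ ⇒ Schoenflies ball, which is a 5-dimensional
PRODUCT statement, not an h-cobordism argument.
- Literature.Barriers.SmoothPoincare4.TwistedSphereBarrierFour: consistent — Γ₄ = 0 is used (inside
the Melvin dictionary, regluing balls), never contradicted.
- Literature.Barriers.SmoothPoincare4.OneStabilisationBarrier: does not apply — the stabiliser is
ℂℙ², not S²×S², and the statements are about closed homotopy spheres, not contractible pieces
(Kang's corks have boundary).
- SPC4-shielding (BARRIERS.lean §D.1): it does bite — all three cruxes are SPC4-implied
(consequences_of_spc4), so a kill is an exotic S⁴ and the route's value is the why-easier of DIG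
(dual line, not unknotting) and the

History (route lifecycle, newest last):
- 2026-08-23T23:10:53Z · DORMANT — reconciler: no traction for 6.3 d (last activity item-evidence-added at 2026-08-17T14:48:41Z); parked, not closed — `ledger route dormant route-SmoothPoincare4- (operator:999:1391023)
- 2026-08-30T04:23:29Z · REACTIVATED — reconciler: reactivated — activity statement-attached at 2026-08-30T03:15:46Z after parking at 2026-08-23T23:10:53Z (operator:999:2010136)

sub-problem: SmoothPoincare4 · status: open · opened planner-plan-lens3-SmoothPoincare4-decomp-g2-0 2026-08-17T04:14:24Z · rev 1 · ledger route-SmoothPoincare4-DissolvableGluck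
GENERATED by the gate from the ledger (D-0016/17). Provers cite these decls: `theorem foo : Summit.SmoothPoincare4.SmoothPoincare4.Theses.DissolvableGluck.<Decl> := …` in Summits/SmoothPoincare4/SmoothPoincare4/Theorems/<Name>.lean.
-/

namespace Summit.SmoothPoincare4.SmoothPoincare4.Theses.DissolvableGluck

open scoped BigOperators Topology Manifold Classical MeasureTheory ProbabilityTheory Matrix InnerProductSpace ComplexConjugate ContinuousMap
open Filter Set Function TopologicalSpace MeasureTheory

attribute [summit_statement] _root_.SmoothPoincare4

open Literature.SPC4

/-- item stmt-SmoothPoincare4-17708 · target · rank 0 · open · by planner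
why it might fail: It is SPC4 on ℂℙ²-dissolvable spheres ⊇ all Gluck twists: one exotic Gluck twist or one dissolvable non-Gluck exotic sphere kills it (= DIG ∧ GLUCK, proved).
sources: Kirby1997, Melvin1977, Gabai2020, ManolescuMarengonSarkarWillis2023, GordonKirby1984
[target] X₁ — every smooth homotopy 4-sphere M admitting a connected sum P of M with ℂℙ² that is
diffeomorphic to ℂℙ² is diffeomorphic to S⁴ (TwistorDissolution's CP2Cancellation at n = 1, one sum
instead of a chain; the tree's IsConnectedSum is orientation-free, so both M # ℂℙ² and M # ℂℙ²bar
readings are included). -/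
@[route_item "route-SmoothPoincare4-DissolvableGluck"]
def CP2CancellationOne : Prop :=
  open scoped ContDiff in ∀ (M : Type) [TopologicalSpace M] [T2Space M] [SecondCountableTopology M] [ChartedSpace (EuclideanSpace ℝ (Fin 4)) M] [IsManifold (𝓡 4) ∞ M], ContinuousMap.HomotopyEquiv M (Metric.sphere (0 : EuclideanSpace ℝ (Fin 5)) 1) → (∃ (P : Type) (_ : TopologicalSpace P) (_ : T2Space P) (_ : SecondCountableTopology P) (_ : ChartedSpace (EuclideanSpace ℝ (Fin 4)) P) (_ : IsManifold (𝓡 4) ∞ P), Literature.Topology.FourManifolds.IsConnectedSum (𝓡 4) (𝓡 4) (𝓡 4) M Literature.Topology.FourManifolds.ComplexProjectivePlane P ∧ Nonempty (P ≃ₘ⟮𝓡 4, 𝓡 4⟯ Literature.Topology.FourManifolds.ComplexProjectivePlane)) → Nonempty (M ≃ₘ⟮𝓡 4, 𝓡 4⟯ Metric.sphere (0 : EuclideanSpace ℝ (Fin 5)) 1)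

/-- item stmt-SmoothPoincare4-17709 · crux · rank 2 · open · by planner
why it might fail: Every dual of the degree-one sphere has odd Euler number, so Gabai's light-bulb/tubing moves (Gabai2020 Lem. 2.3) are unavailable and no engine embeds the Whitney discs; a dissolvable exotic sphere that is not a Gluck twist refutes it (SPC4-shielded).
sources: Melvin1977, Gabai2020, Kirby1997, Gompf1991, arXiv:1705.09989
[crux] DIG — if M is a smooth homotopy 4-sphere and some connected sum of M with ℂℙ² is
diffeomorphic to ℂℙ², then M is a Gluck twist of S⁴ along some smooth 2-knot K (tree `IsGluckTwist
(𝓡 4) M K`). On paper (Melvin1977 = Gabai2020 Rem. 10.17): the (±1)-sphere S ⊂ ℂℙ² whose complement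
is the punctured M can be re-chosen to meet a line transversally in one point; blowing down along
that line turns S into K and M into Σ_K. Birth line bc/DissolvableIsGluck_birth.lean:
stub_blowUpPresentation (dictionary) → stub_dualLine (the crux proper) → stub_melvinBlowDown
(Melvin). [difficulty: open-problem] -/
@[route_item "route-SmoothPoincare4-DissolvableGluck", crux]
def DissolvableIsGluck : Prop :=
  open scoped ContDiff in ∀ (M : Type) [TopologicalSpace M] [T2Space M] [SecondCountableTopology M] [ChartedSpace (EuclideanSpace ℝ (Fin 4)) M] [IsManifold (𝓡 4) ∞ M], ContinuousMap.HomotopyEquiv M (Metric.sphere (0 : EuclideanSpace ℝ (Fin 5)) 1) → (∃ (P : Type) (_ : TopologicalSpace P) (_ : T2Space P) (_ : SecondCountableTopology P) (_ : ChartedSpace (EuclideanSpace ℝ (Fin 4)) P) (_ : IsManifold (𝓡 4) ∞ P), Literature.Topology.FourManifolds.IsConnectedSum (𝓡 4) (𝓡 4) (𝓡 4) M Literature.Topology.FourManifolds.ComplexProjectivePlane P ∧ Nonempty (P ≃ₘ⟮𝓡 4, 𝓡 4⟯ Literature.Topology.FourManifolds.ComplexProjectivePlane)) → ∃ K : Literature.Topology.FourManifolds.TwoKnot,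 Literature.Topology.FourManifolds.IsGluckTwist (𝓡 4) M K

/-- item stmt-SmoothPoincare4-17710 · crux · rank 3 · open · by planner
why it might fail: Stronger than MMSW Q9.12 (∃ r, D(P) only): r = 1 for EVERY Σ; all printed dissolutions (Gluck twists GS Ex. 5.2.7b, AC-trivial D(P), Akbulut–Yasui odd-form criterion) start from a sphere/handle datum a general Σ lacks; an exotic ℂℙ²-sum kills it.
sources: ManolescuMarengonSarkarWillis2023, arXiv:1910.08195, GompfStipsicz1999, AkbulutYasui2013, KasprowskiPowellRay2023, FreedmanGompfMorrisonWalker2010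
[crux] DISSOLVE₁ — every smooth homotopy 4-sphere M has a connected sum P of M with ℂℙ²
(orientation-free IsConnectedSum) diffeomorphic to ℂℙ². The r = 1, all-Σ form of ℂℙ²-dissolution
(MMSW 2023 Question 9.12 asks ∃ r and only for balanced-presentation spheres D(P)); a consequence of
SPC4 (proved: dissolveOne_of_spc4). Birth line bc/DissolveOne_birth.lean transfers
TwistorDissolution to level one: stub_selfDualLevelOne (a PSC half-conformally-flat metric on some M
# ℂℙ²) → stub_poonLevelOne (Poon 1986: positive-type self-dual with τ = 1 is ℂℙ²). [difficulty:
open-problem] -/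
@[route_item "route-SmoothPoincare4-DissolvableGluck", crux]
def DissolveOne : Prop :=
  open scoped ContDiff in ∀ (M : Type) [TopologicalSpace M] [T2Space M] [SecondCountableTopology M] [ChartedSpace (EuclideanSpace ℝ (Fin 4)) M] [IsManifold (𝓡 4) ∞ M], ContinuousMap.HomotopyEquiv M (Metric.sphere (0 : EuclideanSpace ℝ (Fin 5)) 1) → ∃ (P : Type) (_ : TopologicalSpace P) (_ : T2Space P) (_ : SecondCountableTopology P) (_ : ChartedSpace (EuclideanSpace ℝ (Fin 4)) P) (_ : IsManifold (𝓡 4) ∞ P), Literature.Topology.FourManifolds.IsConnectedSum (𝓡 4) (𝓡 4) (𝓡 4) M Literature.Topology.FourManifolds.ComplexProjectivePlane P ∧ Nonempty (P ≃ₘ⟮𝓡 4, 𝓡 4⟯ Literature.Topology.FourManifolds.ComplexProjectivePlane)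

/-- item stmt-SmoothPoincare4-17711 · crux · rank 4 · open · by planner
why it might fail: Open since 1962 (Kirby 4.24/4.45) and widely suspected false: non-ribbon, non-twist-spun 2-knots (e.g. Cappell–Shaneson-type or knots with no 0-concordance to a ribbon knot) may give exotic Σ_K; every known detector is blind (A2, A3, A7).
sources: GluckTAMS1962, Kirby1997, GabaiNaylorSchwartz2025, arXiv:2307.06388, Gompf1991, Akbulut2010
[crux] GLUCK — the Gluck twist conjecture: for every smooth 2-knot K and every smooth 4-manifold X
that is a Gluck twist of S⁴ along K, X ≅ S⁴. Verbatim the body of the registered open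
`Literature.Topology.FourManifolds.GluckTwistConjecture.{0}` (Iff.rfl, gluckTwistsStandard_iff),
inlined as this route's own crux per the conjecture rule; = X₁ restricted to Gluck twists
(gluck_of_cancel, proved). Birth line bc/GluckTwistsStandard_birth.lean: §17 (tree theorem) +
stub_gluckInvertible (GNS 2025 Q5.6: Gluck twists are invertible / Schoenflies balls) +
stub_invertibleStandard (= OneStabInvertible.InvertibleStandard, stmt-SmoothPoincare4-18065).
[difficulty: open-problem] -/
@[route_item "route-SmoothPoincare4-DissolvableGluck", crux]
def GluckTwistsStandard : Prop :=
  open scoped ContDiff in ∀ (K : Literature.Topology.FourManifolds.TwoKnot) (X : Type) [TopologicalSpace X] [T2Space X] [SecondCountableTopology X] [ChartedSpace (EuclideanSpace ℝ (Fin 4)) X] [IsManifold (𝓡 4) ∞ X], Literature.Topology.FourManifolds.IsGluckTwist (𝓡 4) X K → Nonempty (X ≃ₘ⟮𝓡 4, 𝓡 4⟯ Metric.sphere (0 : EuclideanSpace ℝ (Fin 5)) 1)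

/-- item stmt-SmoothPoincare4-17712 · support · rank 9 · closed · proved by Summit.SmoothPoincare4.SmoothPoincare4.Theorems.DissolvableGluckSplitGlue.splitGlue_holds (prover) · by planner
sources: Melvin1977, Gabai2020
[support] X_of_subs — DIG → GLUCK → X₁ (the typed split's implication; PROVED in the planner's
Sketch.lean, theorem splitGlue_holds, 3 lines of logic). [difficulty: provable-now] -/
@[route_item "route-SmoothPoincare4-DissolvableGluck"]
def SplitGlue : Prop :=
  DissolvableIsGluck → GluckTwistsStandard → CP2CancellationOne

-- `SplitGlue` holds: proved by `Summit.SmoothPoincare4.SmoothPoincare4.Theorems.DissolvableGluckSplitGlue.splitGlue_holds` (its module imports this route file, so no `_holds` link can be stated here).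

/-- item stmt-SmoothPoincare4-17713 · support · rank 9 · open · by planner
sources: GluckTAMS1962, KasprowskiPowellRay2023, GompfStipsicz1999
[support] the split is exact — X₁ ↔ (DIG ∧ GLUCK). PROVED in Sketch.lean (splitExact_holds): X₁ →
DIG because S⁴ is the Gluck twist of the unknot (tree theorem isGluckTwist_sphere_unknotTwo_holds,
transported by IsOpenGluing.diffeomorph_comp_of_boundaryless); X₁ → GLUCK because a Gluck twist is a
homotopy sphere (IsGluckTwist.nonempty_homotopyEquiv_sphere, Gluck §17, discharged) and dissolves
(gluckTwist_connectedSum_complexProjectivePlane_holds, discharged) along a connected sum that exists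
(exists_isConnectedSum_holds). Needs the proof-only imports GluckTwistHomotopySphereProofs,
GluckTwistUnknotProofs, KnotsProofs, HomotopyS4CompactProofs, ConnectedSumExistence,
ConnectedSumTransportProofs, Barriers.SmoothPoincare4.GluckTwistsDissolveConnectedSumProofs in the
Theorems file. [difficulty: provable-now] -/
@[route_item "route-SmoothPoincare4-DissolvableGluck"]
def SplitExact : Prop :=
  CP2CancellationOne ↔ (DissolvableIsGluck ∧ GluckTwistsStandard)

/-- item stmt-SmoothPoincare4-17714 · assembly · rank 1 · open · by planner
sources: Melvin1977, GluckTAMS1962, ManolescuMarengonSarkarWillis2023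
[assembly] DissolveOne → DissolvableIsGluck → GluckTwistsStandard → SmoothPoincare4. -/
@[route_item "route-SmoothPoincare4-DissolvableGluck"]
def Assembly : Prop :=
  DissolveOne → DissolvableIsGluck → GluckTwistsStandard → _root_.SmoothPoincare4

/-! D-0027 §2.1 — DECIDING THEOREM (planner-authored via `route open/edit --closes-file`; by planner-plan-lens3-SmoothPoincare4-decomp-g2-0 2026-08-17T04:14:24Z):
its hypotheses are this route's items and its conclusion the sub-problem Statement (glue_lint), and it elaborates with this file. -/

@[closes "route-SmoothPoincare4-DissolvableGluck"] theorem closes (h₁ : DissolveOne) (h₂ : DissolvableIsGluck) (h₃ : GluckTwistsStandard) :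
    _root_.SmoothPoincare4 := by
  intro M _ _ _ _ _ e
  obtain ⟨K, hK⟩ := h₂ M e (h₁ M e)
  exact h₃ K M hK

end Summit.SmoothPoincare4.SmoothPoincare4.Theses.DissolvableGluck
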